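import Summits.CriticalPhenomena.PercolationContinuityZ3.Theorems.PercNearOneGluingNoHeavyLowerTailSahiCombTriWAntiNested
import Summits.CriticalPhenomena.PercolationContinuityZ3.Theorems.PercNearOneGluingNoHeavyLowerTailSahiCombFourChainIneq

/-!
# AN♯3 as a RANK statement: the kernel form (typed, with a fixed visibility design) implies `AntiNestedChainHall`

Support file of the one-cut programme (crux `NoHeavyLowerTail`, stmt-CriticalPhenomena-4575; TRI lane of cell `prim-masterthm`; seat prim-lf-1 gen 37,
memo `FROM-prim-lf-1-gen37-ANTINESTED-AND-LOCALITY.md` §2).  Companion of `…SahiCombTriWAntiNested` (identity + `AntiNestedChainHall → anti-nested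
stratum of TRI_W(2)`) and of the four-chain rank files `…SahiCombFourChainRank` / `…SahiCombFourChainIneq` (AN♯1, the model).

The four-chain Hall inequality AN♯3 (`FiveUpSet.AntiNestedChainHall`: six demand classes `a = P ∩ refl Σ'`, `b = P∩F₀∩refl G₃`, `c = P∩refl F₀∩G₃`,
`d = P∩F₃∩refl G₀`, `e = P∩F₂∩refl G₂`, `f = P∩refl F₂∩G₂` against the five nested supply levels `X₁ = F₃G₃ ⊇ X₂ = F₂G₃ ⊇ X₃ = F₁G₂ ∪ F₂G₁ ⊇ X₄ = F₀G₂
⊇ X₅ = F₀G₀`, inside `P`) follows — exactly as AN♯1 follows from `fourChain_kernel_eq_zero_of_upperSet` — from the linear independence of the demand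
rows of a `{0,1}` inclusion matrix `[s ⊆ t]` in which each class sees only some levels (a VISIBILITY DESIGN).  Cell P5 gen 16 found by computer
(harvest + sound elementary prover `cprove2`, `prim-masterthm-p5/code16/py/an3_best_sliced.pkl`) the design
`a ↦ {1,2}`, `b ↦ {1,4,5}`, `c ↦ {1,2}`, `d ↦ {1}`, `e ↦ {2,3}`, `f ↦ {1,3,5}` together with a 61-step elimination log; prim-lf-1 gen 37 re-checked
it numerically (full row rank mod `2³¹−1` on 300 / 150 / 30 random pairs of 4-chains at `n = 3 / 4 / 5`).  This file fixes that design in the tree: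

* `FiveUpSet.AntiNestedKernel` (`@[conjecture]`, OURS) — the kernel statement inside an up-set `P`: coefficient vectors `ka … kf` supported on the
  six classes with `E₁: Z a + Z b + Z c + Z d + Z f = 0` on `P ∩ X₁`, `E₂: Z a + Z c + Z e = 0` on `P ∩ X₂`, `E₃: Z e + Z f = 0` on `P ∩ X₃`,
  `E₄: Z b = 0` on `P ∩ X₄`, `E₅: Z b + Z f = 0` on `P ∩ X₅` (`Z x t = Σ_s x s [s ⊆ t]`) all vanish;
* **`FiveUpSet.antiNestedChainHall_of_kernel : AntiNestedKernel → AntiNestedChainHall`** (linear independence ⇒ `#demands ≤ #supplies`);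
* **`FiveUpSet.triW_nonneg_of_antiNested_of_kernel`** — hence `AntiNestedKernel → 0 ≤ triW P F G` on the anti-nested stratum.
What remains for an unconditional anti-nested stratum is the kernel lemma itself (pattern: `fourChain_kernel_eq_zero` — antipodal bases, support lemma,
C1/C2′; the P5 log is the blueprint).
HONEST LABEL: plumbing only (a typed rank statement and its counting corollary); no new unconditional theorem. [this work]
-/

namespace Summit.CriticalPhenomena.PercolationContinuityZ3.Theorems

namespace FiveUpSet

open Finset

variable {α : Type} [DecidableEq α] [Fintype α]

/-- **AN♯3, kernel form inside an up-set `P` with the P5 gen-16 visibility design** (CONJECTURE of ours — a linear-algebra statement, census /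
rank-checked, not proved here): for chains of up-sets `F₀ ⊆ F₁ ⊆ F₂ ⊆ F₃`, `G₀ ⊆ G₁ ⊆ G₂ ⊆ G₃`, an up-set `P`, and coefficient vectors
`ka, kb, kc, kd, ke, kf : Finset α → ℚ` supported on the six demand classes (inside `P`), the five level equations force all six vectors to vanish. [this work] -/
@[conjecture] def AntiNestedKernel : Prop :=
  ∀ (α : Type) [DecidableEq α] [Fintype α] (P F₀ F₁ F₂ F₃ G₀ G₁ G₂ G₃ : Finset (Finset α)),
    IsUpperSet (P : Set (Finset α)) →
    IsUpperSet (F₀ : Set (Finset α)) → IsUpperSet (F₁ : Set (Finset α)) → IsUpperSet (F₂ : Set (Finset α)) → IsUpperSet (F₃ : Set (Finset α)) →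
    IsUpperSet (G₀ : Set (Finset α)) → IsUpperSet (G₁ : Set (Finset α)) → IsUpperSet (G₂ : Set (Finset α)) → IsUpperSet (G₃ : Set (Finset α)) →
    F₀ ⊆ F₁ → F₁ ⊆ F₂ → F₂ ⊆ F₃ → G₀ ⊆ G₁ → G₁ ⊆ G₂ → G₂ ⊆ G₃ →
    ∀ (ka kb kc kd ke kf : Finset α → ℚ),
    (∀ s, ka s ≠ 0 → s ∈ P ∧ sᶜ ∈ ((F₃ \ F₀) ∩ (G₃ \ G₀)) \ ((F₂ \ F₁) ∩ (G₂ \ G₁))) →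
    (∀ s, kb s ≠ 0 → s ∈ P ∧ s ∈ F₀ ∧ sᶜ ∈ G₃) →
    (∀ s, kc s ≠ 0 → s ∈ P ∧ sᶜ ∈ F₀ ∧ s ∈ G₃) →
    (∀ s, kd s ≠ 0 → s ∈ P ∧ s ∈ F₃ ∧ sᶜ ∈ G₀) →
    (∀ s, ke s ≠ 0 → s ∈ P ∧ s ∈ F₂ ∧ sᶜ ∈ G₂) →
    (∀ s, kf s ≠ 0 → s ∈ P ∧ sᶜ ∈ F₂ ∧ s ∈ G₂) →
    (∀ t, t ∈ P → t ∈ F₃ → t ∈ G₃ →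
      ∑ s, ka s * (if s ⊆ t then (1 : ℚ) else 0) + ∑ s, kb s * (if s ⊆ t then (1 : ℚ) else 0)
        + ∑ s, kc s * (if s ⊆ t then (1 : ℚ) else 0) + ∑ s, kd s * (if s ⊆ t then (1 : ℚ) else 0)
        + ∑ s, kf s * (if s ⊆ t then (1 : ℚ) else 0) = 0) →
    (∀ t, t ∈ P → t ∈ F₂ → t ∈ G₃ →
      ∑ s, ka s * (if s ⊆ t then (1 : ℚ) else 0) + ∑ s, kc s * (if s ⊆ t then (1 : ℚ) else 0)
        + ∑ s, ke s * (if s ⊆ t then (1 : ℚ) else 0) = 0) →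
    (∀ t, t ∈ P → (t ∈ F₁ ∧ t ∈ G₂) ∨ (t ∈ F₂ ∧ t ∈ G₁) →
      ∑ s, ke s * (if s ⊆ t then (1 : ℚ) else 0) + ∑ s, kf s * (if s ⊆ t then (1 : ℚ) else 0) = 0) →
    (∀ t, t ∈ P → t ∈ F₀ → t ∈ G₂ → ∑ s, kb s * (if s ⊆ t then (1 : ℚ) else 0) = 0) →
    (∀ t, t ∈ P → t ∈ F₀ → t ∈ G₀ →
      ∑ s, kb s * (if s ⊆ t then (1 : ℚ) else 0) + ∑ s, kf s * (if s ⊆ t then (1 : ℚ) else 0) = 0) →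
    (∀ s, ka s = 0) ∧ (∀ s, kb s = 0) ∧ (∀ s, kc s = 0) ∧ (∀ s, kd s = 0) ∧ (∀ s, ke s = 0) ∧ (∀ s, kf s = 0)

/-- The zeta entry `[s ⊆ t]` of the inclusion matrix, as a rational. [this work] -/
def zent (s t : Finset α) : ℚ := if s ⊆ t then 1 else 0

/-- **AN♯3 from its kernel form** (the counting corollary): `AntiNestedKernel → AntiNestedChainHall`.  The demand rows of the design matrix are linearly
independent vectors of `ℚ^{supplies}` (the kernel statement read through `Fintype.linearIndependent_iff`), so their number — `antiNestedDemand` — is at most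
the dimension `antiNestedSupply`. [this work] -/
theorem antiNestedChainHall_of_kernel (hK : AntiNestedKernel) : AntiNestedChainHall := by
  intro α _ _ P F₀ F₁ F₂ F₃ G₀ G₁ G₂ G₃ hP hF₀ hF₁ hF₂ hF₃ hG₀ hG₁ hG₂ hG₃ hF₀₁ hF₁₂ hF₂₃ hG₀₁ hG₁₂ hG₂₃
  set Sig : Finset (Finset α) := ((F₃ \ F₀) ∩ (G₃ \ G₀)) \ ((F₂ \ F₁) ∩ (G₂ \ G₁)) with hSig
  -- supply index type: the five levels inside `P` (syntactically as in `antiNestedSupply`)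
  -- a row vector on the supplies, given the five visibility flags of a class
  let row : Bool → Bool → Bool → Bool → Bool → Finset α →
      (↥(P ∩ F₃ ∩ G₃) ⊕ (↥(P ∩ F₂ ∩ G₃) ⊕ (↥(P ∩ (F₁ ∩ G₂ ∪ F₂ ∩ G₁)) ⊕ (↥(P ∩ F₀ ∩ G₂) ⊕ ↥(P ∩ F₀ ∩ G₀))))) → ℚ :=
    fun v1 v2 v3 v4 v5 s =>
      Sum.elim (fun t => if v1 then zent s (t : Finset α) else 0)
        (Sum.elim (fun t => if v2 then zent s (t : Finset α) else 0)
          (Sum.elim (fun t => if v3 then zent s (t : Finset α) else 0)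
            (Sum.elim (fun t => if v4 then zent s (t : Finset α) else 0) (fun t => if v5 then zent s (t : Finset α) else 0))))
  have hli : LinearIndependent ℚ
      (Sum.elim (fun s : ↥(P ∩ refl Sig) => row true true false false false s)
        (Sum.elim (fun s : ↥(P ∩ F₀ ∩ refl G₃) => row true false false true true s)
          (Sum.elim (fun s : ↥(P ∩ refl F₀ ∩ G₃) => row true true false false false s)
            (Sum.elim (fun s : ↥(P ∩ F₃ ∩ refl G₀) => row true false false false false s)
              (Sum.elim (fun s : ↥(P ∩ F₂ ∩ refl G₂) => row false true true false false s)
                (fun s : ↥(P ∩ refl F₂ ∩ G₂) => row true false true false true s)))))) := by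
    rw [Fintype.linearIndependent_iff]
    intro g hg
    -- the six coefficient vectors on the cube
    obtain ⟨ka, hka⟩ : ∃ f : Finset α → ℚ, ∀ s, f s = if h : s ∈ P ∩ refl Sig then g (Sum.inl ⟨s, h⟩) else 0 := ⟨_, fun _ => rfl⟩
    obtain ⟨kb, hkb⟩ : ∃ f : Finset α → ℚ, ∀ s, f s = if h : s ∈ P ∩ F₀ ∩ refl G₃ then g (Sum.inr (Sum.inl ⟨s, h⟩)) else 0 :=
      ⟨_, fun _ => rfl⟩
    obtain ⟨kc, hkc⟩ : ∃ f : Finset α → ℚ, ∀ s,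
        f s = if h : s ∈ P ∩ refl F₀ ∩ G₃ then g (Sum.inr (Sum.inr (Sum.inl ⟨s, h⟩))) else 0 := ⟨_, fun _ => rfl⟩
    obtain ⟨kd, hkd⟩ : ∃ f : Finset α → ℚ, ∀ s,
        f s = if h : s ∈ P ∩ F₃ ∩ refl G₀ then g (Sum.inr (Sum.inr (Sum.inr (Sum.inl ⟨s, h⟩)))) else 0 := ⟨_, fun _ => rfl⟩
    obtain ⟨ke, hke⟩ : ∃ f : Finset α → ℚ, ∀ s,
        f s = if h : s ∈ P ∩ F₂ ∩ refl G₂ then g (Sum.inr (Sum.inr (Sum.inr (Sum.inr (Sum.inl ⟨s, h⟩))))) else 0 := ⟨_, fun _ => rfl⟩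
    obtain ⟨kf, hkf⟩ : ∃ f : Finset α → ℚ, ∀ s,
        f s = if h : s ∈ P ∩ refl F₂ ∩ G₂ then g (Sum.inr (Sum.inr (Sum.inr (Sum.inr (Sum.inr ⟨s, h⟩))))) else 0 := ⟨_, fun _ => rfl⟩
    have hkasupp : ∀ s, ka s ≠ 0 → s ∈ P ∩ refl Sig := by
      intro s hs; by_contra h; rw [hka s, dif_neg h] at hs; exact hs rfl
    have hkbsupp : ∀ s, kb s ≠ 0 → s ∈ P ∩ F₀ ∩ refl G₃ := by
      intro s hs; by_contra h; rw [hkb s, dif_neg h] at hs; exact hs rfl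
    have hkcsupp : ∀ s, kc s ≠ 0 → s ∈ P ∩ refl F₀ ∩ G₃ := by
      intro s hs; by_contra h; rw [hkc s, dif_neg h] at hs; exact hs rfl
    have hkdsupp : ∀ s, kd s ≠ 0 → s ∈ P ∩ F₃ ∩ refl G₀ := by
      intro s hs; by_contra h; rw [hkd s, dif_neg h] at hs; exact hs rfl
    have hkesupp : ∀ s, ke s ≠ 0 → s ∈ P ∩ F₂ ∩ refl G₂ := by
      intro s hs; by_contra h; rw [hke s, dif_neg h] at hs; exact hs rfl
    have hkfsupp : ∀ s, kf s ≠ 0 → s ∈ P ∩ refl F₂ ∩ G₂ := by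
      intro s hs; by_contra h; rw [hkf s, dif_neg h] at hs; exact hs rfl
    -- sums over the index finsets are sums over the cube
    have suma := sum_coe_zeta_eq_sum_ext (P ∩ refl Sig) (fun s => g (Sum.inl s)) ka hka
    have sumb := sum_coe_zeta_eq_sum_ext (P ∩ F₀ ∩ refl G₃) (fun s => g (Sum.inr (Sum.inl s))) kb hkb
    have sumc := sum_coe_zeta_eq_sum_ext (P ∩ refl F₀ ∩ G₃) (fun s => g (Sum.inr (Sum.inr (Sum.inl s)))) kc hkc
    have sumd := sum_coe_zeta_eq_sum_ext (P ∩ F₃ ∩ refl G₀) (fun s => g (Sum.inr (Sum.inr (Sum.inr (Sum.inl s))))) kd hkd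
    have sume := sum_coe_zeta_eq_sum_ext (P ∩ F₂ ∩ refl G₂) (fun s => g (Sum.inr (Sum.inr (Sum.inr (Sum.inr (Sum.inl s)))))) ke hke
    have sumf := sum_coe_zeta_eq_sum_ext (P ∩ refl F₂ ∩ G₂) (fun s => g (Sum.inr (Sum.inr (Sum.inr (Sum.inr (Sum.inr s)))))) kf hkf
    -- the five equations, read off the components of `hg`
    have E1 : ∀ t, t ∈ P → t ∈ F₃ → t ∈ G₃ →
        ∑ s, ka s * (if s ⊆ t then (1 : ℚ) else 0) + ∑ s, kb s * (if s ⊆ t then (1 : ℚ) else 0)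
          + ∑ s, kc s * (if s ⊆ t then (1 : ℚ) else 0) + ∑ s, kd s * (if s ⊆ t then (1 : ℚ) else 0)
          + ∑ s, kf s * (if s ⊆ t then (1 : ℚ) else 0) = 0 := by
      intro t htP htF htG
      have h := congrFun hg (Sum.inl ⟨t, mem_inter.2 ⟨mem_inter.2 ⟨htP, htF⟩, htG⟩⟩)
      rw [Finset.sum_apply, Fintype.sum_sum_type, Fintype.sum_sum_type, Fintype.sum_sum_type, Fintype.sum_sum_type,
        Fintype.sum_sum_type] at h
      simp only [row, zent, Pi.smul_apply, smul_eq_mul, Pi.zero_apply, Sum.elim_inl, Sum.elim_inr, mul_zero,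
        Finset.sum_const_zero, if_true, if_false, Bool.false_eq_true] at h
      rw [suma t, sumb t, sumc t, sumd t, sumf t] at h
      linarith [h]
    have E2 : ∀ t, t ∈ P → t ∈ F₂ → t ∈ G₃ →
        ∑ s, ka s * (if s ⊆ t then (1 : ℚ) else 0) + ∑ s, kc s * (if s ⊆ t then (1 : ℚ) else 0)
          + ∑ s, ke s * (if s ⊆ t then (1 : ℚ) else 0) = 0 := by
      intro t htP htF htG
      have h := congrFun hg (Sum.inr (Sum.inl ⟨t, mem_inter.2 ⟨mem_inter.2 ⟨htP, htF⟩, htG⟩⟩))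
      rw [Finset.sum_apply, Fintype.sum_sum_type, Fintype.sum_sum_type, Fintype.sum_sum_type, Fintype.sum_sum_type,
        Fintype.sum_sum_type] at h
      simp only [row, zent, Pi.smul_apply, smul_eq_mul, Pi.zero_apply, Sum.elim_inl, Sum.elim_inr, mul_zero,
        Finset.sum_const_zero, if_true, if_false, Bool.false_eq_true] at h
      rw [suma t, sumc t, sume t] at h
      linarith [h]
    have E3 : ∀ t, t ∈ P → (t ∈ F₁ ∧ t ∈ G₂) ∨ (t ∈ F₂ ∧ t ∈ G₁) →
        ∑ s, ke s * (if s ⊆ t then (1 : ℚ) else 0) + ∑ s, kf s * (if s ⊆ t then (1 : ℚ) else 0) = 0 := by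
      intro t htP ht
      have htV : t ∈ P ∩ (F₁ ∩ G₂ ∪ F₂ ∩ G₁) := by
        refine mem_inter.2 ⟨htP, ?_⟩
        rcases ht with h | h
        · exact mem_union.2 (Or.inl (mem_inter.2 h))
        · exact mem_union.2 (Or.inr (mem_inter.2 h))
      have h := congrFun hg (Sum.inr (Sum.inr (Sum.inl ⟨t, htV⟩)))
      rw [Finset.sum_apply, Fintype.sum_sum_type, Fintype.sum_sum_type, Fintype.sum_sum_type, Fintype.sum_sum_type,
        Fintype.sum_sum_type] at h
      simp only [row, zent, Pi.smul_apply, smul_eq_mul, Pi.zero_apply, Sum.elim_inl, Sum.elim_inr, mul_zero,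
        Finset.sum_const_zero, if_true, if_false, Bool.false_eq_true] at h
      rw [sume t, sumf t] at h
      linarith [h]
    have E4 : ∀ t, t ∈ P → t ∈ F₀ → t ∈ G₂ → ∑ s, kb s * (if s ⊆ t then (1 : ℚ) else 0) = 0 := by
      intro t htP htF htG
      have h := congrFun hg (Sum.inr (Sum.inr (Sum.inr (Sum.inl ⟨t, mem_inter.2 ⟨mem_inter.2 ⟨htP, htF⟩, htG⟩⟩))))
      rw [Finset.sum_apply, Fintype.sum_sum_type, Fintype.sum_sum_type, Fintype.sum_sum_type, Fintype.sum_sum_type,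
        Fintype.sum_sum_type] at h
      simp only [row, zent, Pi.smul_apply, smul_eq_mul, Pi.zero_apply, Sum.elim_inl, Sum.elim_inr, mul_zero,
        Finset.sum_const_zero, if_true, if_false, Bool.false_eq_true] at h
      rw [sumb t] at h
      linarith [h]
    have E5 : ∀ t, t ∈ P → t ∈ F₀ → t ∈ G₀ →
        ∑ s, kb s * (if s ⊆ t then (1 : ℚ) else 0) + ∑ s, kf s * (if s ⊆ t then (1 : ℚ) else 0) = 0 := by
      intro t htP htF htG
      have h := congrFun hg (Sum.inr (Sum.inr (Sum.inr (Sum.inr ⟨t, mem_inter.2 ⟨mem_inter.2 ⟨htP, htF⟩, htG⟩⟩))))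
      rw [Finset.sum_apply, Fintype.sum_sum_type, Fintype.sum_sum_type, Fintype.sum_sum_type, Fintype.sum_sum_type,
        Fintype.sum_sum_type] at h
      simp only [row, zent, Pi.smul_apply, smul_eq_mul, Pi.zero_apply, Sum.elim_inl, Sum.elim_inr, mul_zero,
        Finset.sum_const_zero, if_true, if_false, Bool.false_eq_true] at h
      rw [sumb t, sumf t] at h
      linarith [h]
    -- the kernel statement
    have K := hK α P F₀ F₁ F₂ F₃ G₀ G₁ G₂ G₃ hP hF₀ hF₁ hF₂ hF₃ hG₀ hG₁ hG₂ hG₃ hF₀₁ hF₁₂ hF₂₃ hG₀₁ hG₁₂ hG₂₃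
      ka kb kc kd ke kf ?_ ?_ ?_ ?_ ?_ ?_ E1 E2 E3 E4 E5
    · rintro (⟨s, hs⟩ | ⟨s, hs⟩ | ⟨s, hs⟩ | ⟨s, hs⟩ | ⟨s, hs⟩ | ⟨s, hs⟩)
      · have h := K.1 s
        rwa [hka s, dif_pos hs] at h
      · have h := K.2.1 s
        rwa [hkb s, dif_pos hs] at h
      · have h := K.2.2.1 s
        rwa [hkc s, dif_pos hs] at h
      · have h := K.2.2.2.1 s
        rwa [hkd s, dif_pos hs] at h
      · have h := K.2.2.2.2.1 s
        rwa [hke s, dif_pos hs] at h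
      · have h := K.2.2.2.2.2 s
        rwa [hkf s, dif_pos hs] at h
    · intro s hs
      have h := hkasupp s hs
      exact ⟨(mem_inter.1 h).1, mem_refl.1 (mem_inter.1 h).2⟩
    · intro s hs
      have h := hkbsupp s hs
      exact ⟨(mem_inter.1 (mem_inter.1 h).1).1, (mem_inter.1 (mem_inter.1 h).1).2, mem_refl.1 (mem_inter.1 h).2⟩
    · intro s hs
      have h := hkcsupp s hs
      exact ⟨(mem_inter.1 (mem_inter.1 h).1).1, mem_refl.1 (mem_inter.1 (mem_inter.1 h).1).2, (mem_inter.1 h).2⟩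
    · intro s hs
      have h := hkdsupp s hs
      exact ⟨(mem_inter.1 (mem_inter.1 h).1).1, (mem_inter.1 (mem_inter.1 h).1).2, mem_refl.1 (mem_inter.1 h).2⟩
    · intro s hs
      have h := hkesupp s hs
      exact ⟨(mem_inter.1 (mem_inter.1 h).1).1, (mem_inter.1 (mem_inter.1 h).1).2, mem_refl.1 (mem_inter.1 h).2⟩
    · intro s hs
      have h := hkfsupp s hs
      exact ⟨(mem_inter.1 (mem_inter.1 h).1).1, mem_refl.1 (mem_inter.1 (mem_inter.1 h).1).2, (mem_inter.1 h).2⟩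
  -- count: independent vectors are at most the dimension
  have hcard := hli.fintype_card_le_finrank
  rw [Module.finrank_fintype_fun_eq_card] at hcard
  simp only [Fintype.card_sum, Fintype.card_coe] at hcard
  rw [hSig] at hcard
  unfold antiNestedDemand antiNestedSupply
  omega

/-- **Kernel form ⟹ the anti-nested stratum of `TRI_W(2)`**: `AntiNestedKernel → 0 ≤ triW P F G` for every up-set `P` and monotone families of up-sets
`F, G` over an index cube with two atoms `a ≠ b` such that `F {b} ⊆ F {a}` and `G {a} ⊆ G {b}` (`antiNestedChainHall_of_kernel` +
`triW_nonneg_of_antiNested`). [this work] -/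
theorem triW_nonneg_of_antiNested_of_kernel (hK : AntiNestedKernel) {γ : Type} [DecidableEq γ] [Fintype γ] {β : Type} [DecidableEq β]
    [Fintype β] {a b : β} (hab : a ≠ b) (hu : (univ : Finset β) = {a, b}) (P : Finset (Finset γ)) (F G : Finset β → Finset (Finset γ))
    (hP : IsUpperSet (P : Set (Finset γ))) (hF : ∀ x, IsUpperSet (F x : Set (Finset γ))) (hG : ∀ x, IsUpperSet (G x : Set (Finset γ)))
    (hFm : Monotone F) (hGm : Monotone G) (hFba : F {b} ⊆ F {a}) (hGab : G {a} ⊆ G {b}) :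
    0 ≤ triW P F G :=
  triW_nonneg_of_antiNested (antiNestedChainHall_of_kernel hK) hab hu P F G hP hF hG hFm hGm hFba hGab

end FiveUpSet

end Summit.CriticalPhenomena.PercolationContinuityZ3.Theorems
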